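import Literature.AnabelianGeometry.EtaleTheta.FrobenioidThetaBiKummer
import Literature.AnabelianGeometry.EtaleTheta.AutConjugation
import Mathlib.CategoryTheory.Types.Basic
import Mathlib.Tactic.Group

/-!
# [EtTh] §5: constant multiple indeterminacy of systems — Corollary 5.12 and Remarks 5.10.1–5.12.9 (pp. 335–348 / PDF pp. 109–122)

Mochizuki, *The étale theta function …*, Publ. RIMS **45** (2009) [cite: MochizukiEtTh2009, §5 p.339 (PDF p.113)].
Seat abc-iut-L2-t4.  Over the §5 data `ThetaFrobenioid` and the general Lemma 5.11 of
`AutConjugation.lean` (PROVED there):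
* the data of **Corollary 5.12** (p.339 (PDF p.113)): a second root `s^⊓_{N'}, s^⊔_{N'} : A_{N'} → B_{N'}`, `N ∣ N'`,
  `M = N'/N ≠ 1`, with the commutative squares through `α_{N,N'}`, `β_{N,N'}` (isometries of Frobenius
  degree `M`, `α_{N,N'}` of base-Frobenius type) — `ConstantMultiple.RootMorphismData`;
* **Cor. 5.12 (i)** `IsoClassesDistinct`, **(ii)** `ExistsLinearIota`, **(iii)**
  `ConstantMultipleIndeterminacy` — and (iii) is PROVED from (i) (`constantMultipleIndeterminacy_of`)
  exactly as in the text ("in light of assertion (i), assertion (iii) follows immediately from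
  Lemma 5.11", p.341 (PDF p.115)), in fact for arbitrary `κ_A, κ_B, κ'` (the restriction to
  `(O_K^×)^{1/N}|_A, (O_K^×)^{1/N}, (O_K^×)^*` plays no role in the existence of `Ξ`);
* the mathematical kernels of Remarks 5.12.2 (`AutActsTrivially`: "`Aut_E(E)` act as the identity on
  `D_E`") and 5.12.5 (iii) (`AutExtensionExact`: the exact sequence
  `1 → O^×(−) → Aut_C((−)) → Aut_D((−)^bs) → 1` for Aut-ample objects);
* [IUTchIII] Rmk 2.1.1 refers to Cor. 5.12 + Rmks. 5.12.1, 5.12.2 as the "isomorphism class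
  compatibility" property (d) (plan/L2/ASSIGNMENTS.md E4; informational).

Remarks recorded as documentation only (commentary / motivation, no formal content beyond the decls
named; first sentences quoted, pages printed/PDF):
* Rmk 5.10.1 (p.335 (PDF p.109)/109): "Theorem 5.10, (iii), may be interpreted as asserting that a mono-theta
  environment may be 'extracted' from the tempered Frobenioids under consideration in a purely
  category-theoretic fashion … a sort of minimal core common to both the étale-theoretic and
  Frobenioid-theoretic approaches to the theta function."
* Rmk 5.10.2 (p.336 (PDF p.110)/110): "The structure of a Frobenioid may be thought of as consisting of a sort
  of extension structure of the base category by various line bundles … The theta section portion of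
  a mono-theta environment may be thought as a sort of canonical splitting of this extension."
* Rmk 5.10.3 (pp.336–337 (PDF pp.110–111)/110–111): the "distinct cyclotome" `μ_N(B_N) ≅ Ker(E^Π_N ↠ Π^tp_Y)` as a
  "Frobenius germ"; "These actions of `ℕ_{≥1}` only make sense within the tempered Frobenioid `C`";
  its arithmetic kernel (`M ≡ 1 mod N`) is `SectionTorsionSubgroup.remark_5_10_3`.
* Rmk 5.10.4 (i)–(iii) (pp.337–338 (PDF pp.111–112)/111–112): (i) "The use of Frobenioids allows one to consider, in a
  natural way, the monoid `(Θ̈(√−1)⁻¹·Θ̈)^ℕ` of powers of the theta function"; (ii) working with `C`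
  rather than `C^birat` gives access to "the 'numerator' and 'denominator' of a meromorphic function
  as separate, independent entities"; (iii) Frobenioids "tend to be compatible with 'Frobenius-like'
  structures".
* Rmk 5.12.1 (p.341 (PDF p.115)/115): `Aut_E(E)` is a group — `AutConjugation.remark_5_12_1`; temperoids
  represent the topology "via the use of numerous objects corresponding to the various open subgroups".
* Rmk 5.12.3 (pp.342–343 (PDF pp.116–117)/116–117): projective systems of mono-theta environments force "the
  'constant multiple indeterminacy' of Corollary 5.12, (iii)"; "(a) cyclotomic rigidity (b) discrete
  rigidity (c) constant multiple rigidity".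
* Rmk 5.12.4 (pp.343–344 (PDF pp.117–118)/117–118): "applying Theorem 5.10, (iii), at each finite step" avoids the
  sacrifice — "a matter of 'how one arranges one's parentheses'".
* Rmk 5.12.5 (i)–(iv) (pp.344–346 (PDF pp.118–120)/118–120): `M`-th power versions; (iii) the exact sequence typed below
  and "shifting automorphisms"; (iv) no way to keep inner-automorphism indeterminacies while
  eliminating constant multiple indeterminacies.
* Rmk 5.12.6 (p.346 (PDF p.120)/120), 5.12.7 (i)–(ii) (p.347 (PDF p.121)/121), 5.12.8 (p.347 (PDF p.121)/121), 5.12.9 (pp.347–348 (PDF pp.121–122)/121–122):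
  multiplicative vs additive structures; birationalization loses discreteness; inner-automorphism
  invariance of the group-theoretic constructions; "the more pieces of data that one considers the
  greater the indeterminacies".
HONEST FRAMING: typed ≠ proved except where a `theorem` says so; no side taken on downstream claims.
-/

namespace Literature.AnabelianGeometry.EtaleTheta

open CategoryTheory
open scoped Pointwise

universe w₁ w v v' u u'

namespace ConstantMultiple

variable {C : Type u} [Category.{v} C] {D : Type u'} [Category.{v'} D]

/-- The additional data of **[EtTh] Corollary 5.12** (p.339 (PDF p.113)): "assume further that `N' ≥ 1` is an
integer such that `N` divides `N'`, but `M := N'/N ≠ 1`; `s^⊓_{N'}, s^⊔_{N'} : A_{N'} → B_{N'}` an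
`N'`-th root of a right fraction-pair of an `l`-th root of the theta function `Θ̈` such that there
exists a pair of commutative diagrams [`s^⊓_{N'} ; β_{N,N'} = α_{N,N'} ; s^⊓_N` and the same with `⊔`]
— where `α_{N,N'}` (respectively, `β_{N,N'}`) is an isometry of Frobenius degree `M ≠ 1`;
`α_{N,N'}` is of base-Frobenius type [cf. Remark 4.3.2]", together with the constants
`K^× ↪ O^×(B_{N'}^birat)` used in (iii).  [cite: MochizukiEtTh2009, Cor 5.12 p.339 (PDF p.113)] -/
structure RootMorphismData (𝔉 : ThetaFrobenioid.{w} C D) (V : FrobenioidThetaBiKummer.BiKummerVocabStub 𝔉)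
    where
  /-- "`N' ≥ 1` … such that `N` divides `N'`" -/
  N' : ℕ+
  /-- `N ∣ N'` -/
  dvd : (𝔉.N : ℕ) ∣ N'
  /-- "`M := N'/N ≠ 1`" -/
  ne : 𝔉.N ≠ N'
  /-- `A_{N'}` -/
  AN' : C
  /-- `B_{N'}` -/
  BN' : C
  /-- `s^⊓_{N'} : A_{N'} → B_{N'}` -/
  sCap' : AN' ⟶ BN'
  /-- `s^⊔_{N'} : A_{N'} → B_{N'}` -/
  sCup' : AN' ⟶ BN'
  /-- "an `N'`-th root of a right fraction-pair of an `l`-th root of the theta function `Θ̈`" -/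
  isRoot : ∃ (A' : C) (g : 𝔉.biratUnits A'), V.IsRootOf 𝔉.l g 𝔉.thetaFn ∧
    V.IsRootOfRightFractionPair N' g sCap' sCup'
  /-- `α_{N,N'} : A_{N'} → A_N` -/
  α : AN' ⟶ 𝔉.AN
  /-- `β_{N,N'} : B_{N'} → B_N` -/
  β : BN' ⟶ 𝔉.BN
  /-- the first commutative square: `s^⊓_{N'} ; β = α ; s^⊓_N` -/
  comm_sCap : sCap' ≫ β = α ≫ 𝔉.sCap
  /-- the second commutative square: `s^⊔_{N'} ; β = α ; s^⊔_N` -/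
  comm_sCup : sCup' ≫ β = α ≫ 𝔉.sCup
  /-- `α_{N,N'}` is an isometry … -/
  isIsometry_α : 𝔉.IsIsometry α
  /-- … of Frobenius degree `M = N'/N` -/
  degFr_α : (𝔉.degFr α : ℕ) * 𝔉.N = N'
  /-- `β_{N,N'}` is an isometry … -/
  isIsometry_β : 𝔉.IsIsometry β
  /-- … of Frobenius degree `M` -/
  degFr_β : (𝔉.degFr β : ℕ) * 𝔉.N = N'
  /-- "`α_{N,N'}` is of base-Frobenius type" -/
  baseFrob_α : 𝔉.IsBaseFrobeniusType α
  /-- the constants `K^× ↪ O^×(B_{N'}^birat)` (Lemma 5.8 for `N'`), used for `(O_K^×)^*` in (iii) -/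
  constEmb' : 𝔉.Kˣ →* 𝔉.biratUnits BN'

variable {𝔉 : ThetaFrobenioid.{w} C D} {V : FrobenioidThetaBiKummer.BiKummerVocabStub 𝔉}
  (R : RootMorphismData 𝔉 V)

/-- **[EtTh] Corollary 5.12 (i)** (p.339 (PDF p.113)): "The isomorphism classes of `A_N`, `B_N`, and `B_{N'}` are
distinct."  [cite: MochizukiEtTh2009, Cor 5.12 (i) p.339 (PDF p.113)] -/
def IsoClassesDistinct : Prop :=
  IsEmpty (𝔉.AN ≅ 𝔉.BN) ∧ IsEmpty (𝔉.AN ≅ R.BN') ∧ IsEmpty (𝔉.BN ≅ R.BN')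

/-- **[EtTh] Corollary 5.12 (ii)** (p.340 (PDF p.114)): "There exists a linear morphism `ι : B_{N'} → B_N`
[cf. the proof of Proposition 5.5]."  [cite: MochizukiEtTh2009, Cor 5.12 (ii) p.340 (PDF p.114)] -/
def ExistsLinearIota : Prop := ∃ ι : R.BN' ⟶ 𝔉.BN, 𝔉.IsLinear ι

/-- `(O_K^×)^{1/N}|_A ⊆ O^×(A_N)`, "the subgroup induced by `(O_K^×)^{1/N} ⊆ O^×(B_N)` [cf. Lemma 5.8]
via `s^⊓_N` or `s^⊔_N`" (Cor. 5.12 (iii), p.340 (PDF p.114)): transport of units along the pre-step `s^⊓_N`.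
[cite: MochizukiEtTh2009, Cor 5.12 (iii) p.340 (PDF p.114)] -/
def OKxRootNA : Subgroup (Aut 𝔉.AN) :=
  ((𝔉.OKxRootN.comap (𝔉.units 𝔉.BN).subtype).map (𝔉.unitsPull 𝔉.sCap)).map (𝔉.units 𝔉.AN).subtype

/-- `(O_K^×)^{1/N'} ⊆ O^×(B_{N'})` (Lemma 5.8 with `N'` for `N`).
[cite: MochizukiEtTh2009, Cor 5.12 (iii) p.340 (PDF p.114)] -/
def OKxRootN' : Subgroup (Aut R.BN') :=
  (((R.constEmb'.range).comap (powMonoidHom (R.N' : ℕ))).comap (𝔉.unitsToBirat R.BN')).map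
    (𝔉.units R.BN').subtype

/-- `(O_K^×)^* ⊆ O^×(B_{N'})`, "the subgroup `((O_K^×)^{1/N'})^{M/deg_Fr(ζ)}`" for `ζ : B_{N'} → B_N`
either `β_{N,N'}` (degree `M`: exponent `1`) or `ι` (degree `1`: exponent `M`) (Cor. 5.12 (iii),
p.340 (PDF p.114)); for a general `ζ` we use the exponent `M / deg_Fr(ζ)` (natural-number division).
[cite: MochizukiEtTh2009, Cor 5.12 (iii) p.340 (PDF p.114)] -/
def OKxStar (ζ : R.BN' ⟶ 𝔉.BN) : Set (Aut R.BN') :=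
  (fun w : Aut R.BN' => w ^ (((R.N' : ℕ) / 𝔉.N) / (𝔉.degFr ζ : ℕ))) '' (OKxRootN' R : Set (Aut R.BN'))

/-- **[EtTh] Corollary 5.12 (iii)** (p.340 (PDF p.114)): "Let `ζ : B_{N'} → B_N` be either `β_{N,N'}` or `ι` …
Then for any `κ_A ∈ (O_K^×)^{1/N}|_A`, `κ_B ∈ (O_K^×)^{1/N}`, `κ' ∈ (O_K^×)^*`, there exists a
self-equivalence `Ξ : C ⥲ C` that is isomorphic to the identity self-equivalence via an isomorphism
that maps `A_N ↦ κ_A⁻¹`, `B_N ↦ κ_B⁻¹`, `B_{N'} ↦ (κ')⁻¹` and all other objects of `C` to the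
corresponding identity automorphism. In particular, `Ξ` maps `s^⊓_N ↦ κ_B⁻¹ ∘ s^⊓_N ∘ κ_A`;
`s^⊔_N ↦ κ_B⁻¹ ∘ s^⊔_N ∘ κ_A`; `ζ ↦ κ_B⁻¹ ∘ ζ ∘ κ'`; and `Im(s^trv_N) ↦ κ_A⁻¹ · Im(s^trv_N) · κ_A`;
`Im(s^⊓-gp_N) ↦ κ_B⁻¹ · Im(s^⊓-gp_N) · κ_B`; `Im(s^⊔-gp_N) ↦ κ_B⁻¹ · Im(s^⊔-gp_N) · κ_B`."  The
self-equivalence is the `Ξ = cor512Xi A_N B_N B_{N'} κ_A κ_B κ'` of `AutConjugation.lean` (with its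
isomorphism `conjFunctorIso` to `𝟭`).  [cite: MochizukiEtTh2009, Cor 5.12 (iii) p.340 (PDF p.114)] -/
def ConstantMultipleIndeterminacy (ζ : R.BN' ⟶ 𝔉.BN) : Prop :=
  ∀ κA ∈ OKxRootNA (𝔉 := 𝔉), ∀ κB ∈ 𝔉.OKxRootN, ∀ κ' ∈ OKxStar R ζ,
    let Ξ := cor512Xi 𝔉.AN 𝔉.BN R.BN' κA κB κ'
    let e := conjFunctorIso (cor512Sys 𝔉.AN 𝔉.BN R.BN' κA κB κ')
    (∀ J, Ξ.obj J = J) ∧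
    e.hom.app 𝔉.AN = κA.inv ∧ e.hom.app 𝔉.BN = κB.inv ∧ e.hom.app R.BN' = κ'.inv ∧
    (∀ J, J ≠ 𝔉.AN → J ≠ 𝔉.BN → J ≠ R.BN' → e.hom.app J = 𝟙 J) ∧
    Ξ.map 𝔉.sCap = κA.hom ≫ 𝔉.sCap ≫ κB.inv ∧ Ξ.map 𝔉.sCup = κA.hom ≫ 𝔉.sCup ≫ κB.inv ∧
    Ξ.map ζ = κ'.hom ≫ ζ ≫ κB.inv ∧
    (𝔉.strv.range).map (Ξ.mapAut 𝔉.AN) = MulAut.conj κA⁻¹ • 𝔉.strv.range ∧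
    (𝔉.sgpCap.range).map (Ξ.mapAut 𝔉.BN) = MulAut.conj κB⁻¹ • 𝔉.sgpCap.range ∧
    (𝔉.sgpCup.range).map (Ξ.mapAut 𝔉.BN) = MulAut.conj κB⁻¹ • 𝔉.sgpCup.range

/-- **Corollary 5.12 (iii) PROVED from (i)** ("in light of assertion (i), assertion (iii) follows
immediately from Lemma 5.11", proof p.341 (PDF p.115)), for every `ζ : B_{N'} → B_N`.
[cite: MochizukiEtTh2009, Cor 5.12 proof p.341 (PDF p.115)] -/
theorem constantMultipleIndeterminacy_of (hi : IsoClassesDistinct R) (ζ : R.BN' ⟶ 𝔉.BN) :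
    ConstantMultipleIndeterminacy R ζ := by
  obtain ⟨h1, h2, h3⟩ := hi
  have hAB : 𝔉.AN ≠ 𝔉.BN := ne_of_isEmpty_iso h1
  have hAB' : 𝔉.AN ≠ R.BN' := ne_of_isEmpty_iso h2
  have hBB' : 𝔉.BN ≠ R.BN' := ne_of_isEmpty_iso h3
  intro κA _ κB _ κ' _
  refine ⟨fun J => rfl, cor_5_12_iii_core_iso_app_A κA κB κ',
    cor_5_12_iii_core_iso_app_B κA κB κ' hAB, cor_5_12_iii_core_iso_app_B' κA κB κ' hAB' hBB',
    fun J hJA hJB hJB' => lemma_5_11_iso_app_other _ _ _ _ _ _ hJA hJB hJB',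
    cor_5_12_iii_core_map_s κA κB κ' hAB _, cor_5_12_iii_core_map_s κA κB κ' hAB _,
    cor_5_12_iii_core_map_zeta κA κB κ' hAB hAB' hBB' ζ,
    cor_5_12_iii_core_subgroup_A κA κB κ' _, cor_5_12_iii_core_subgroup_B κA κB κ' hAB _,
    cor_5_12_iii_core_subgroup_B κA κB κ' hAB _⟩

/-- **[EtTh] Corollary 5.12** (pp.339–340 (PDF pp.113–114)), the three assertions together, for `ζ = β_{N,N'}`:
(i), (ii), and (iii).  [cite: MochizukiEtTh2009, Cor 5.12 p.339–340 (PDF pp.113–114)] -/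
def ConstantMultipleIndeterminacyOfSystems : Prop :=
  IsoClassesDistinct R ∧ ExistsLinearIota R ∧ ConstantMultipleIndeterminacy R R.β ∧
    ∀ ι : R.BN' ⟶ 𝔉.BN, 𝔉.IsLinear ι → ConstantMultipleIndeterminacy R ι

/-- The (iii)-part of Corollary 5.12 needs only (i): PROVED reduction.
[cite: MochizukiEtTh2009, Cor 5.12 proof p.341 (PDF p.115)] -/
theorem constantMultipleIndeterminacyOfSystems_of (hi : IsoClassesDistinct R)
    (hii : ExistsLinearIota R) : ConstantMultipleIndeterminacyOfSystems R :=
  ⟨hi, hii, constantMultipleIndeterminacy_of R hi R.β,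
    fun ι _ => constantMultipleIndeterminacy_of R hi ι⟩

end ConstantMultiple

/-! ### The mathematical kernels of Remarks 5.12.2 and 5.12.5 (iii) -/

section Remarks

variable {C : Type u} [Category.{v} C]

/-- [EtTh] Remark 5.12.2 (p.342 (PDF p.116)): for data `E ↦ D_E` "which one may think of as a functor on the
full subcategory of `E` consisting of objects whose isomorphism class belongs to `I`", "One necessary
condition for the data … to form a coherent system is the condition that the data `D_E` be invariant
with respect to the various automorphisms induced by the various `Aut_E(E)` — i.e., that `Aut_E(E)`
act as the identity on `D_E`" (there being "no natural, 'category-theoretic' choice [cf. Lemma 5.11]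
of a particular morphism" among the composites `α_F ∘ ζ ∘ α_E`).  The condition, for a
`Type`-valued functor `Dat` and an object `E`.  [cite: MochizukiEtTh2009, Rmk 5.12.2 p.342 (PDF p.116)] -/
def AutActsTrivially (Dat : C ⥤ Type w₁) (E : C) : Prop :=
  ∀ α : Aut E, Dat.map α.hom = 𝟙 (Dat.obj E)

/-- [EtTh] Remark 5.12.2, the indeterminacy it describes: the composites `α_F ∘ ζ ∘ α_E` of a
morphism `ζ : E → F` with automorphisms — the orbit within which Lemma 5.11 shows no member is
category-theoretically distinguished.  [cite: MochizukiEtTh2009, Rmk 5.12.2 p.342 (PDF p.116)] -/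
def autDoubleCosetOrbit {E F : C} (ζ : E ⟶ F) : Set (E ⟶ F) :=
  {ζ' | ∃ (αE : Aut E) (αF : Aut F), ζ' = αE.hom ≫ ζ ≫ αF.hom}

variable {D : Type u'} [Category.{v'} D] (𝔉 : ThetaFrobenioid.{w} C D)

/-- [EtTh] Remark 5.12.5 (iii) (p.345 (PDF p.119)): "the 'extension structure' … of the exact sequence
`1 → O^×(−) → Aut_C((−)) → Aut_D((−)^bs) → 1` [for objects '`(−)`', such as `B_{N'}`, `B_N`, which are
Aut-ample — cf. the discussion preceding Lemma 5.8]" — the exactness statement for an object `S` of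
the §5 Frobenioid.  [cite: MochizukiEtTh2009, Rmk 5.12.5 (iii) p.345 (PDF p.119)] -/
def AutExtensionExact (S : C) : Prop :=
  𝔉.units S = (𝔉.autBase S).ker ∧ Function.Surjective (𝔉.autBase S)

/-- [EtTh] Remark 5.12.5 (iii) (p.345 (PDF p.119)): the "shifting automorphisms" of `Aut_C(S)` "arising from
cocycles of `Aut_D((−)^bs)` with coefficients in `O^×(−)`": for a map `c : Aut_D(S^bs) → O^×(S)`,
the self-map `a ↦ c(a^bs) · a` of `Aut_C(S)` (a group automorphism when `c` is a 1-cocycle for the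
conjugation action; it induces the identity on `O^×(S)` and on `Aut_D(S^bs)` — "unipotent
upper-triangular").  [cite: MochizukiEtTh2009, Rmk 5.12.5 (iii) p.345 (PDF p.119)] -/
def shiftingMap (S : C) (c : Aut (𝔉.base.obj S) → 𝔉.units S) : Aut S → Aut S :=
  fun a => (c (𝔉.autBase S a) : Aut S) * a

/-- The cocycle condition making `shiftingMap` multiplicative: `c(p(ab)) = c(p a) · a c(p b) a⁻¹`.
[cite: MochizukiEtTh2009, Rmk 5.12.5 (iii) p.345 (PDF p.119)] -/
def IsShiftingCocycle (S : C) (c : Aut (𝔉.base.obj S) → 𝔉.units S) : Prop :=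
  ∀ a b : Aut S, (c (𝔉.autBase S (a * b)) : Aut S) =
    (c (𝔉.autBase S a) : Aut S) * (a * (c (𝔉.autBase S b) : Aut S) * a⁻¹)

/-- For a shifting cocycle, the shifting map is multiplicative (hence a "shifting automorphism").
[cite: MochizukiEtTh2009, Rmk 5.12.5 (iii) p.345 (PDF p.119)] -/
theorem shiftingMap_mul (S : C) {c : Aut (𝔉.base.obj S) → 𝔉.units S}
    (hc : IsShiftingCocycle 𝔉 S c) (a b : Aut S) :
    shiftingMap 𝔉 S c (a * b) = shiftingMap 𝔉 S c a * shiftingMap 𝔉 S c b := by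
  simp only [shiftingMap]
  rw [hc a b]
  group

end Remarks

end Literature.AnabelianGeometry.EtaleTheta
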